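import Mathlib
import Summits.Ventures.PercRepro2.HCov
import Summits.Ventures.PercRepro2.EdgeCubic
import Summits.Ventures.PercRepro2.EdgeCubicAll
import Summits.Ventures.PercRepro2.CPolarA3
import Summits.Ventures.PercRepro2.CPolarA3Marks
import Summits.Ventures.PercRepro2.PendantA3Pins
import Summits.Ventures.PercRepro2.PendantClusterPins
import Summits.Ventures.PercRepro2.PendantClusterMasses
import Summits.Ventures.PercRepro2.PendantClusterBern
import Summits.Ventures.PercRepro2.CPolarSub
import Summits.Ventures.PercRepro2.CPolarSubClasses
import Summits.Ventures.PercRepro2.CPolarSubPlus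

/-!
# (HCOV⁺) PASSES FROM THE IDENTIFIED INSTANCE TO A PENDANT `a₃` — the pendant face of the road on
the quartic is a theorem (blind cell PercRepro2, p5 g16; `proofs/P5-OEDGE.md` §22)

Let the reach `K` of `a₃` be mark-free with a single fractional boundary edge `f = {z, u}` of weight
`t` (a pendant `a₃`-cluster, PendantClusterPins.lean). Along `f` the strengthened form
`HCovPlus = Q·Gc + covU·slackB` (CPolarSubPlus.lean) collapses: `Q` is constant, the masses of `a₃`
pin to `t·(mass of u) + (1 − t)·(mass of the isolated a₃)`, so `covU(t) = t·covU(u)` and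
`slackB(t) = t·slackB(u)`, while `Gc(t)` is the landed cubic `(1 − t)³Gc₀ + t(1 − t)²B1 + t²(1 − t)B2 +
t³Gc₁` with `B1 = (1 + α)Gc₀ + H/D`, `B2 = Gc₁ + αGc₀ + H/D` (`H := Q·Gc₁ + cov·slack` the
(HCOV⁺) value of the identified instance `(o, a₁, a₂, u, b)`). Everything assembles to the identity

  `D · HCovPlus(t) = D·Gc₀·(1 − t)·[Q(1 − t)² + (Q + D)t(1 − t) + Dt²] + H·t·[Q(1 − t) + tD]`

(**`quartic_pendant_identity`**, pure `ring`): with `Gc₀ ≥ 0` (the isolated `a₃`, BHK) every term is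
nonnegative. Hence **`hcovPlus_of_pendant`**: (HCOV⁺) at the identified instance `(o, a₁, a₂, u, b)`
implies (HCOV⁺) at `p` — for EVERY weight of `f`, positively or negatively correlated attachment
alike, with no (HCOV) hypothesis at the open pin. The pendant face of a `(HCOV) ∧ (HCOV⁺)` induction
is therefore closed on both components (the cubic's by `sub_of_pendant_of_hcovPlus`, the quartic's
here), and the union-cluster obstruction (β) of the cubic road does not reappear for the quartic.
-/

namespace Summit.Ventures.PercRepro2

open UnionCluster CovForm CovForm.CPolarA3 PendantA3 PendantCluster CPolarSub CPolarSubClasses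
  CPolarSubPlus

namespace QuarticPendant

open EdgeLine

/-! ## The polynomial identity -/

section Poly

variable {R : Type*} [Field R]

/-- **The pendant identity for the quartic** (pure `ring`): with the closed pin `(Q, Q, Qo, EQbo, 0, 0,
EQo, 0, 0, Qb, Qbo, gap)` and the open pin `(Q, D, Do, EQbo, EQb3, EQb3o, EQo, EQ3, EQ3o, PDb, PDbo,
gap)` of the pendant edge at weight `t`,
`D · [Q·Gc(t) + covU(t)·slackB(t)] = D·Gc₀·(1 − t)·(Q(1 − t)² + (Q + D)t(1 − t) + Dt²) + H·t·(Q(1 − t) + tD)`,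
`H = Q·Gc₁ + (Qo·D − Q·Do)·(Q·EQb3 + gap·EQ3 + Q·PDb − D·Qb)`. -/
lemma quartic_pendant_identity (Q gap EQbo EQo Qo Qb Qbo D Do EQb3 EQb3o EQ3 EQ3o PDb PDbo t : R) :
    D * (Q * ((1 - t) ^ 3 * GcPoly Q Q Qo EQbo 0 0 EQo 0 0 Qb Qbo gap +
          t * (1 - t) ^ 2 * B1Poly Q Q Qo EQbo 0 0 EQo 0 0 Qb Qbo gap
            Q D Do EQbo EQb3 EQb3o EQo EQ3 EQ3o PDb PDbo gap +
          t ^ 2 * (1 - t) * B2Poly Q Q Qo EQbo 0 0 EQo 0 0 Qb Qbo gap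
            Q D Do EQbo EQb3 EQb3o EQo EQ3 EQ3o PDb PDbo gap +
          t ^ 3 * GcPoly Q D Do EQbo EQb3 EQb3o EQo EQ3 EQ3o PDb PDbo gap) +
        (Qo * (t * D + (1 - t) * Q) - Q * (t * Do + (1 - t) * Qo)) *
          (Q * (t * EQb3 + (1 - t) * 0) + gap * (t * EQ3 + (1 - t) * 0) +
            Q * (t * PDb + (1 - t) * Qb) - (t * D + (1 - t) * Q) * Qb)) =
      D * GcPoly Q Q Qo EQbo 0 0 EQo 0 0 Qb Qbo gap * (1 - t) *
          (Q * (1 - t) ^ 2 + (Q + D) * t * (1 - t) + D * t ^ 2) +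
        (Q * GcPoly Q D Do EQbo EQb3 EQb3o EQo EQ3 EQ3o PDb PDbo gap +
            (Qo * D - Q * Do) * (Q * EQb3 + gap * EQ3 + Q * PDb - D * Qb)) *
          t * (Q * (1 - t) + t * D) := by
  unfold B1Poly B2Poly GcPoly polar1 polar2
  ring

variable [LinearOrder R] [IsStrictOrderedRing R]

/-- **The pendant inequality for the quartic**: `0 ≤ t ≤ 1`, `0 ≤ Q`, `0 < D`, `0 ≤ Gc₀` and
`0 ≤ H` give `0 ≤ Q·Gc(t) + covU(t)·slackB(t)`. -/
lemma quartic_pendant_nonneg (Q gap EQbo EQo Qo Qb Qbo D Do EQb3 EQb3o EQ3 EQ3o PDb PDbo t : R)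
    (ht0 : 0 ≤ t) (ht1 : t ≤ 1) (hQ : 0 ≤ Q) (hD : 0 < D)
    (hGc0 : 0 ≤ GcPoly Q Q Qo EQbo 0 0 EQo 0 0 Qb Qbo gap)
    (hH : 0 ≤ Q * GcPoly Q D Do EQbo EQb3 EQb3o EQo EQ3 EQ3o PDb PDbo gap +
      (Qo * D - Q * Do) * (Q * EQb3 + gap * EQ3 + Q * PDb - D * Qb)) :
    0 ≤ Q * ((1 - t) ^ 3 * GcPoly Q Q Qo EQbo 0 0 EQo 0 0 Qb Qbo gap +
          t * (1 - t) ^ 2 * B1Poly Q Q Qo EQbo 0 0 EQo 0 0 Qb Qbo gap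
            Q D Do EQbo EQb3 EQb3o EQo EQ3 EQ3o PDb PDbo gap +
          t ^ 2 * (1 - t) * B2Poly Q Q Qo EQbo 0 0 EQo 0 0 Qb Qbo gap
            Q D Do EQbo EQb3 EQb3o EQo EQ3 EQ3o PDb PDbo gap +
          t ^ 3 * GcPoly Q D Do EQbo EQb3 EQb3o EQo EQ3 EQ3o PDb PDbo gap) +
        (Qo * (t * D + (1 - t) * Q) - Q * (t * Do + (1 - t) * Qo)) *
          (Q * (t * EQb3 + (1 - t) * 0) + gap * (t * EQ3 + (1 - t) * 0) +
            Q * (t * PDb + (1 - t) * Qb) - (t * D + (1 - t) * Q) * Qb) := by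
  have h1t : 0 ≤ 1 - t := sub_nonneg.2 ht1
  have hpoly1 : 0 ≤ Q * (1 - t) ^ 2 + (Q + D) * t * (1 - t) + D * t ^ 2 :=
    add_nonneg (add_nonneg (mul_nonneg hQ (pow_nonneg h1t 2))
      (mul_nonneg (mul_nonneg (add_nonneg hQ hD.le) ht0) h1t)) (mul_nonneg hD.le (pow_nonneg ht0 2))
  have hpoly2 : 0 ≤ Q * (1 - t) + t * D := add_nonneg (mul_nonneg hQ h1t) (mul_nonneg ht0 hD.le)
  have hr := add_nonneg (mul_nonneg (mul_nonneg (mul_nonneg hD.le hGc0) h1t) hpoly1)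
    (mul_nonneg (mul_nonneg hH ht0) hpoly2)
  rw [← quartic_pendant_identity Q gap EQbo EQo Qo Qb Qbo D Do EQb3 EQb3o EQ3 EQ3o PDb PDbo t] at hr
  exact (mul_nonneg_iff_of_pos_left hD).1 hr

end Poly

/-! ## The theorem -/

section Pendant

variable {V : Type*} {E : Type*} [Fintype V] [DecidableEq V] [Fintype E] [DecidableEq E]
  {R : Type*} [Field R] [LinearOrder R] [IsStrictOrderedRing R]

variable {p : E → R} {ends : E → Sym2 V} {f : E} {o a₁ a₂ a₃ b z u : V}

/-- At the closed pin of the single fractional boundary edge of the reach of `a₃`, no fractional edge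
touches the reach, so (HCOV) holds there (`CPolarA3.HCov_of_reach_pinned`). -/
lemma HCov_closed_pendant (hp : IsProbVec p)
    (hK : ∀ e ∈ fracEdges p, TouchesReach p ends a₃ e → e = f) (hf1 : p f ≠ 1) :
    HCov (Function.update p f 0) ends o a₁ a₂ a₃ b := by
  have hp₀ : IsProbVec (Function.update p f 0) := hp.update f le_rfl zero_le_one
  refine HCov_of_reach_pinned (Function.update p f 0) hp₀ ends o a₁ a₂ a₃ b fun e he ht => ?_
  rw [fracEdges_update p f 0 (Or.inl rfl)] at he
  obtain ⟨hne, he'⟩ := Finset.mem_erase.1 he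
  have ht' : TouchesReach p ends a₃ e := by
    unfold TouchesReach at ht ⊢
    rw [pinnedReach_update_zero hf1] at ht
    exact ht
  exact hne (hK e he' ht')

/-- **(HCOV⁺) passes from the identified instance to a pendant `a₃`**: for a mark-free reach of `a₃`
with the single fractional boundary edge `f = {z, u}` and `P(PD_u) > 0`, (HCOV⁺) at `(o, a₁, a₂, u, b)`
gives (HCOV⁺) at `p`, whatever the weight of `f` and the sign of `Cov_ν(U_o, U_u)`. -/
theorem hcovPlus_of_pendant (hp : IsProbVec p)
    (hK : ∀ e ∈ fracEdges p, TouchesReach p ends a₃ e → e = f)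
    (hf : ends f = s(z, u)) (hz : z ∈ pinnedReach p ends a₃) (hu : u ∉ pinnedReach p ends a₃)
    (hf1 : p f ≠ 1) (h1 : a₁ ∉ pinnedReach p ends a₃) (h2 : a₂ ∉ pinnedReach p ends a₃)
    (ho : o ∉ pinnedReach p ends a₃) (hb : b ∉ pinnedReach p ends a₃)
    (hD : 0 < prob p (PDEvent ends a₁ a₂ u))
    (hplus : HCovPlus p ends o a₁ a₂ u b) :
    HCovPlus p ends o a₁ a₂ a₃ b := by
  obtain ⟨hQ0, hD0, hDo0, hEQbo0, hEQb3_0, hEQb3o0, hEQo0, hEQ3_0, hEQ3o0, hPDb0, hPDbo0, hgap0⟩ :=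
    pins_zero_cluster p hK hf hz hu hf1 h1 h2 ho hb
  obtain ⟨hQ1, hD1, hDo1, hEQbo1, hEQb3_1, hEQb3o1, hEQo1, hEQ3_1, hEQ3o1, hPDb1, hPDbo1, hgap1⟩ :=
    pins_one_cluster p hK hf hz hu hf1 h1 h2 ho hb
  -- the closed pin: `a₃` isolated, `Gc₀ ≥ 0`
  have h₀ : HCov (Function.update p f 0) ends o a₁ a₂ a₃ b := HCov_closed_pendant hp hK hf1
  unfold HCov at h₀
  rw [Gc_eq_GcPoly] at h₀
  rw [hQ0, hD0, hDo0, hEQbo0, hEQb3_0, hEQb3o0, hEQo0, hEQ3_0, hEQ3o0, hPDb0, hPDbo0, hgap0] at h₀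
  -- the identified instance
  unfold HCovPlus covU slackB at hplus
  rw [Gc_eq_GcPoly] at hplus
  -- the instance: pin the masses of `a₃` along `f`
  unfold HCovPlus covU slackB
  rw [Gc_pin_cubic p ends o a₁ a₂ a₃ b f, prob_eq_pin p (PDEvent ends a₁ a₂ a₃) f,
    Do_pin p ends o a₁ a₂ a₃ f, EQb3_pin p ends a₁ a₂ a₃ b f, EQ3_pin p ends a₁ a₂ a₃ f,
    PDb_pin p ends a₁ a₂ a₃ b f]
  unfold B1 B2
  rw [Gc_eq_GcPoly (Function.update p f 0), Gc_eq_GcPoly (Function.update p f 1)]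
  rw [hQ0, hD0, hDo0, hEQbo0, hEQb3_0, hEQb3o0, hEQo0, hEQ3_0, hEQ3o0, hPDb0, hPDbo0, hgap0,
    hQ1, hD1, hDo1, hEQbo1, hEQb3_1, hEQb3o1, hEQo1, hEQ3_1, hEQ3o1, hPDb1, hPDbo1, hgap1]
  have hQ : 0 ≤ prob p (avoidAll ends a₂ {a₁}) := prob_nonneg hp _
  have key := quartic_pendant_nonneg (prob p (avoidAll ends a₂ {a₁})) (gap p ends a₁ a₂ b)
    (EQbo p ends o a₁ a₂ b) (EQo p ends o a₁ a₂)
    (prob p (avoidAll ends a₂ {a₁} ∩ connEvent ends a₁ o) +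
      prob p (avoidAll ends a₂ {a₁} ∩ connEvent ends a₂ o))
    (prob p (avoidAll ends a₂ {a₁} ∩ connEvent ends a₁ b) +
      prob p (avoidAll ends a₂ {a₁} ∩ connEvent ends a₂ b))
    (prob p (avoidAll ends a₂ {a₁} ∩ (connEvent ends a₁ o ∩ connEvent ends a₁ b)) +
      prob p (avoidAll ends a₂ {a₁} ∩ (connEvent ends a₂ o ∩ connEvent ends a₁ b)) +
      prob p (avoidAll ends a₂ {a₁} ∩ (connEvent ends a₁ o ∩ connEvent ends a₂ b)) +
      prob p (avoidAll ends a₂ {a₁} ∩ (connEvent ends a₂ o ∩ connEvent ends a₂ b)))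
    (prob p (PDEvent ends a₁ a₂ u)) (Do p ends o a₁ a₂ u) (EQb3 p ends a₁ a₂ u b)
    (EQb3o p ends o a₁ a₂ u b) (EQ3 p ends a₁ a₂ u) (EQ3o p ends o a₁ a₂ u)
    (PDb p ends a₁ a₂ u b) (PDbo p ends o a₁ a₂ u b) (p f) (hp.nonneg f) (hp.le_one f) hQ hD h₀
    hplus
  exact le_of_le_of_eq key (by ring)

end Pendant

end QuarticPendant

end Summit.Ventures.PercRepro2
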